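import Mathlib
import Summits.AnomalousDissipation.AnomalousDissipation.Theorems.SoloBlindChainTailSeed

/-!
# SoloBlind — the γ-cell: monotonicity of the tail rows in `γ = g⁴` and the polynomial sup-norm majorant
(kernel K-R14b, companion of `SoloBlindPowerNeumann`; PLAN §126.4(d))

Remedy R14 certifies the LEMMA-P chains on a cell `γ ∈ [γ_lo, γ_hi]` from data AT ONE POINT.  Two elementary facts the
engine (v1.3 `GTAYLOR`) uses for the whole cell:

* `betaRow_im_mono_gamma`, `norm_betaRow_mono_gamma` — for the rows `β_k(γ) = w + iγ(k² - 1/2)`, `k ≥ 1`: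
  `Im β_k` and (when `Im β_k(γ_lo) ≥ 0`) `|β_k|` are nondecreasing in `γ`; hence the tail-seed hypotheses of
  `ChainTailSeed.roll_tail_dominant` / `streak_tail_dominant` checked at `γ_lo` hold on the whole cell
  (`roll_tail_dominant_cell`, `roll_seed_radius_cell`, `streak_tail_dominant_cell`, `streak_seed_radius_cell`):
  ONE seed ball `‖t_K(γ)‖ ≤ 1/(b - 1 - c_K)` with `b = |β_K(γ_lo)|` serves every `γ ≥ γ_lo`.
* `norm_sum_pow_smul_le` — `‖∑_{i<n} δ^i • c_i‖ ≤ ∑_{i<n} ‖c_i‖ Δ^i` for `‖δ‖ ≤ Δ`: the sup over the cell of a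
  matrix polynomial with exactly computed coefficients (used for `θ = sup ‖s(δ)^p‖` and for the envelopes).
-/

namespace Summit.AnomalousDissipation.SoloBlind.GammaCell

open Finset
open Summit.AnomalousDissipation.SoloBlind.TailOperator
open Summit.AnomalousDissipation.SoloBlind.TailSeedGlue
open Summit.AnomalousDissipation.SoloBlind.ChainTailSeed

/-! ### Monotonicity in `γ` -/

/-- `Im β_k(γ)` is nondecreasing in `γ` for `k ≥ 1`. -/
theorem betaRow_im_mono_gamma (w : ℂ) {γ γ' : ℝ} (hγ : γ ≤ γ') {k : ℕ} (hk : 1 ≤ k) :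
    (betaRow w γ k).im ≤ (betaRow w γ' k).im := by
  rw [betaRow_im, betaRow_im]
  have h1 : (1 : ℝ) ≤ k := by exact_mod_cast hk
  have hpos : (0 : ℝ) ≤ (k : ℝ) ^ 2 - 1 / 2 := by nlinarith
  nlinarith [mul_le_mul_of_nonneg_right hγ hpos]

/-- `|β_k(γ)|` is nondecreasing in `γ ≥ γ_lo` as soon as `Im β_k(γ_lo) ≥ 0` (`k ≥ 1`). -/
theorem norm_betaRow_mono_gamma (w : ℂ) {γ γ' : ℝ} (hγ : γ ≤ γ') {k : ℕ} (hk : 1 ≤ k)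
    (him : 0 ≤ (betaRow w γ k).im) : ‖betaRow w γ k‖ ≤ ‖betaRow w γ' k‖ := by
  have hre : (betaRow w γ k).re = (betaRow w γ' k).re := by rw [betaRow_re, betaRow_re]
  have him' := betaRow_im_mono_gamma w hγ hk
  have hsq : ‖betaRow w γ k‖ ^ 2 ≤ ‖betaRow w γ' k‖ ^ 2 := by
    rw [Complex.sq_norm, Complex.sq_norm, Complex.normSq_apply, Complex.normSq_apply, hre]
    nlinarith
  by_contra hlt
  have hlt : ‖betaRow w γ' k‖ < ‖betaRow w γ k‖ := lt_of_not_ge hlt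
  have h0 := norm_nonneg (betaRow w γ' k)
  nlinarith [mul_pos (by linarith : 0 < ‖betaRow w γ k‖ - ‖betaRow w γ' k‖)
    (by linarith : 0 < ‖betaRow w γ k‖ + ‖betaRow w γ' k‖)]

/-- The seed hypotheses transported from `γ_lo` to any `γ ≥ γ_lo`. -/
theorem seed_hyps_of_lo (w : ℂ) {γlo γ : ℝ} (hle : γlo ≤ γ) {K : ℕ} (hK : 1 ≤ K) {b : ℝ}
    (him : 0 ≤ (betaRow w γlo K).im) (hb : b ≤ ‖betaRow w γlo K‖) :
    0 ≤ (betaRow w γ K).im ∧ b ≤ ‖betaRow w γ K‖ :=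
  ⟨him.trans (betaRow_im_mono_gamma w hle hK), hb.trans (norm_betaRow_mono_gamma w hle hK him)⟩

/-! ### The tail seeds on a γ-cell (hypotheses checked once, at `γ_lo`) -/

/-- **Roll tail dominant on the cell**: the data `Im β_K(γ_lo) ≥ 0`, `b ≤ |β_K(γ_lo)|`, `1 + c_K < b` make the
roll tail at depth `K ≥ 2` dominant for EVERY `γ ≥ γ_lo`. -/
theorem roll_tail_dominant_cell (w : ℂ) {γlo γ : ℝ} (hγlo : 0 ≤ γlo) (hle : γlo ≤ γ) {K : ℕ} (hK : 2 ≤ K)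
    {b : ℝ} (him : 0 ≤ (betaRow w γlo K).im) (hb : b ≤ ‖betaRow w γlo K‖) (hdom : 1 + rollC K < b) :
    Dominant (fun j => ((rollA (K + j) : ℝ) : ℂ)) (fun j => betaRow w γ (K + j))
      (fun j => ((rollC (K + j) : ℝ) : ℂ)) b ((1 + rollC K) / b) :=
  roll_tail_dominant w (hγlo.trans hle) hK
    (seed_hyps_of_lo w hle (le_trans (by norm_num) hK) him hb).1
    (seed_hyps_of_lo w hle (le_trans (by norm_num) hK) him hb).2 hdom

/-- **Roll seed radius on the cell**: `‖t_K(γ)‖ ≤ 1/(b - 1 - c_K)` for every `γ ≥ γ_lo`. -/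
theorem roll_seed_radius_cell (w : ℂ) {γlo γ : ℝ} (hγlo : 0 ≤ γlo) (hle : γlo ≤ γ) {K : ℕ} (hK : 2 ≤ K)
    {b : ℝ} (him : 0 ≤ (betaRow w γlo K).im) (hb : b ≤ ‖betaRow w γlo K‖) (hdom : 1 + rollC K < b) :
    ‖tval (roll_tail_dominant_cell w hγlo hle hK him hb hdom)‖ ≤ 1 / (b - 1 - rollC K) :=
  roll_seed_radius w (hγlo.trans hle) hK
    (seed_hyps_of_lo w hle (le_trans (by norm_num) hK) him hb).1
    (seed_hyps_of_lo w hle (le_trans (by norm_num) hK) him hb).2 hdom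

/-- **Streak tail dominant on the cell** (`K ≥ 1`). -/
theorem streak_tail_dominant_cell (w : ℂ) {γlo γ : ℝ} (hγlo : 0 ≤ γlo) (hle : γlo ≤ γ) {K : ℕ} (hK : 1 ≤ K)
    {b : ℝ} (him : 0 ≤ (betaRow w γlo K).im) (hb : b ≤ ‖betaRow w γlo K‖) (hdom : 1 + 1 < b) :
    Dominant (fun _ => (1 : ℂ)) (fun j => betaRow w γ (K + j)) (fun _ => (1 : ℂ)) b ((1 + 1) / b) :=
  streak_tail_dominant w (hγlo.trans hle) (seed_hyps_of_lo w hle hK him hb).1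
    (seed_hyps_of_lo w hle hK him hb).2 hdom

/-- **Streak seed radius on the cell**: `‖t_K(γ)‖ ≤ 1/(b - 1 - 1)` for every `γ ≥ γ_lo`. -/
theorem streak_seed_radius_cell (w : ℂ) {γlo γ : ℝ} (hγlo : 0 ≤ γlo) (hle : γlo ≤ γ) {K : ℕ} (hK : 1 ≤ K)
    {b : ℝ} (him : 0 ≤ (betaRow w γlo K).im) (hb : b ≤ ‖betaRow w γlo K‖) (hdom : 1 + 1 < b) :
    ‖tval (streak_tail_dominant_cell w hγlo hle hK him hb hdom)‖ ≤ 1 / (b - 1 - 1) :=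
  streak_seed_radius w (hγlo.trans hle) (seed_hyps_of_lo w hle hK him hb).1
    (seed_hyps_of_lo w hle hK him hb).2 hdom

/-! ### Sup-norm of a polynomial with vector / matrix coefficients over the cell -/

section Poly

variable {𝕜 : Type*} [NormedField 𝕜] {E : Type*} [SeminormedAddCommGroup E] [NormedSpace 𝕜 E]

/-- `‖∑_{i<n} δ^i • c_i‖ ≤ ∑_{i<n} ‖c_i‖ Δ^i` whenever `‖δ‖ ≤ Δ` — the majorant the engine applies to the EXACT
coefficients of `s(δ)^p` and of the Taylor polynomial of the resolvent. -/
theorem norm_sum_pow_smul_le (c : ℕ → E) {δ : 𝕜} {Δ : ℝ} (hδ : ‖δ‖ ≤ Δ) (n : ℕ) :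
    ‖∑ i ∈ range n, δ ^ i • c i‖ ≤ ∑ i ∈ range n, ‖c i‖ * Δ ^ i := by
  refine (norm_sum_le _ _).trans (Finset.sum_le_sum fun i _ => ?_)
  rw [norm_smul, norm_pow, mul_comm]
  exact mul_le_mul_of_nonneg_left (pow_le_pow_left₀ (norm_nonneg _) hδ i) (norm_nonneg _)

/-- Entrywise version for a family of coefficients read through a bounded linear functional-free form: if every
coefficient satisfies `‖c_i‖ ≤ C_i` then `‖∑ δ^i • c_i‖ ≤ ∑ C_i Δ^i` (`0 ≤ Δ`). -/
theorem norm_sum_pow_smul_le_of_le (c : ℕ → E) (C : ℕ → ℝ) {δ : 𝕜} {Δ : ℝ} (hΔ : 0 ≤ Δ) (hδ : ‖δ‖ ≤ Δ)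
    (hC : ∀ i, ‖c i‖ ≤ C i) (n : ℕ) :
    ‖∑ i ∈ range n, δ ^ i • c i‖ ≤ ∑ i ∈ range n, C i * Δ ^ i :=
  (norm_sum_pow_smul_le c hδ n).trans
    (Finset.sum_le_sum fun i _ => mul_le_mul_of_nonneg_right (hC i) (pow_nonneg hΔ i))

end Poly

end Summit.AnomalousDissipation.SoloBlind.GammaCell
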